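import Summits.Ventures.Crystal3D.Theorems.StickyWulffConstantPolycrystalWulffBoundZoneRunsChimera

/-!
# From slab-wise to slice-wise section shifts, almost everywhere in the height (engine part 2b for the
# charged zone rung, line `PolyDensity`, crux `stmt-Ventures-19482`)

Route `StickyWulffConstant` of the venture `Summits/Ventures/Crystal3D`, second prover lane (poly-p2,
gen 9).  `cruxWulffBody_twin_slab_cdf_le` (`…TwinSectionShiftSlabHolds`) compares the volumes of the two
twin bodies inside EVERY measurable height slab and every abscissa half-space; the slice-runs engine
(`chimera3_sliceRuns_*`, `…ZoneRunsChimera`) wants the comparison SLICE BY SLICE (areas of planar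
sections).  In frame coordinates (`Fin 3 → ℝ`, height = coordinate `2`, abscissa = coordinate `0`) this
file performs the passage, for arbitrary measurable sets `P, Q`:
* `volume_inter_heightSlab_inter_abscissa_eq_lintegral` — Cavalieri:
  `|P ∩ {x₂ ∈ I} ∩ {x₀ < t}| = ∫⁻_{u ∈ I} |P_u ∩ {p₁ < t}|`;
* `slice_cdf_le_ae_of_slab_cdf_le` — if `|P ∩ {x₂ ∈ I} ∩ {x₀ < t}| ≤ |Q ∩ {x₂ ∈ I} ∩ {x₀ < t + δ}|`
  for all measurable `I` and all `t`, then for a.e. height `u`, for ALL `t`: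
  `|P_u ∩ {p₁ < t}| ≤ |Q_u ∩ {p₁ < t + δ}|` (a.e. for each rational level, then left-continuity in `t`).
WHAT THIS IS NOT: the zone rung (memo P-TWIN-g9 §8 steps 2, 5–8); the crux is not claimed. -/

noncomputable section

namespace Summit.Ventures.Crystal3D.Theorems.Chimera

open MeasureTheory Set Filter
open scoped ENNReal Topology

/-- Cavalieri for a set cut by a height slab and an abscissa half-space:
`|P ∩ {x₂ ∈ I} ∩ {x₀ < t}| = ∫⁻ u in I, |P_u ∩ {p₁ < t}|`. -/
theorem volume_inter_heightSlab_inter_abscissa_eq_lintegral {P : Set (Fin 3 → ℝ)} (hP : MeasurableSet P)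
    {I : Set ℝ} (hI : MeasurableSet I) (t : ℝ) :
    volume (P ∩ {x : Fin 3 → ℝ | x 2 ∈ I} ∩ {x : Fin 3 → ℝ | x 0 < t}) =
      ∫⁻ u in I, volume {p : ℝ × ℝ | (![p.1, p.2, u] : Fin 3 → ℝ) ∈ P ∧ p.1 < t} := by
  have hm : MeasurableSet (P ∩ {x : Fin 3 → ℝ | x 2 ∈ I} ∩ {x : Fin 3 → ℝ | x 0 < t}) :=
    (hP.inter (hI.preimage (measurable_pi_apply 2))).inter
      ((isOpen_lt (continuous_apply 0) continuous_const).measurableSet)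
  rw [volume_eq_lintegral_slice3 _ hm, ← lintegral_indicator hI]
  refine lintegral_congr fun u => ?_
  by_cases hu : u ∈ I
  · rw [indicator_of_mem hu]
    congr 1
    ext p
    simp [hu]
  · rw [indicator_of_notMem hu]
    have : {p : ℝ × ℝ | (![p.1, p.2, u] : Fin 3 → ℝ) ∈
        P ∩ {x : Fin 3 → ℝ | x 2 ∈ I} ∩ {x : Fin 3 → ℝ | x 0 < t}} = ∅ := by
      ext p
      simp [hu]
    rw [this, measure_empty]

/-- The slice profile `u ↦ |P_u ∩ {p₁ < t}|` is measurable. -/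
theorem measurable_volume_slice3_abscissa {P : Set (Fin 3 → ℝ)} (hP : MeasurableSet P) (t : ℝ) :
    Measurable fun u : ℝ => volume {p : ℝ × ℝ | (![p.1, p.2, u] : Fin 3 → ℝ) ∈ P ∧ p.1 < t} := by
  have hm : MeasurableSet (P ∩ {x : Fin 3 → ℝ | x 0 < t}) :=
    hP.inter ((isOpen_lt (continuous_apply 0) continuous_const).measurableSet)
  have h := measurable_volume_slice3 hm
  have heq : (fun u : ℝ => volume {p : ℝ × ℝ | (![p.1, p.2, u] : Fin 3 → ℝ) ∈ P ∧ p.1 < t}) =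
      fun u : ℝ => volume {p : ℝ × ℝ | (![p.1, p.2, u] : Fin 3 → ℝ) ∈ P ∩ {x : Fin 3 → ℝ | x 0 < t}} := by
    funext u
    congr 1
  rw [heq]
  exact h

/-- **Slab-wise section shifts hold slice-wise for a.e. height.**  If
`|P ∩ {x₂ ∈ I} ∩ {x₀ < t}| ≤ |Q ∩ {x₂ ∈ I} ∩ {x₀ < t + δ}|` for every measurable `I` and every `t`,
then for a.e. `u`, for all `t`:
`|P_u ∩ {p₁ < t}| ≤ |Q_u ∩ {p₁ < t + δ}|`. -/
theorem slice_cdf_le_ae_of_slab_cdf_le {P Q : Set (Fin 3 → ℝ)} (hP : MeasurableSet P)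
    (hQ : MeasurableSet Q) {δ : ℝ}
    (hslab : ∀ I : Set ℝ, MeasurableSet I → ∀ t : ℝ,
      volume (P ∩ {x : Fin 3 → ℝ | x 2 ∈ I} ∩ {x : Fin 3 → ℝ | x 0 < t}) ≤
        volume (Q ∩ {x : Fin 3 → ℝ | x 2 ∈ I} ∩ {x : Fin 3 → ℝ | x 0 < t + δ})) :
    ∀ᵐ u : ℝ, ∀ t : ℝ, volume {p : ℝ × ℝ | (![p.1, p.2, u] : Fin 3 → ℝ) ∈ P ∧ p.1 < t} ≤
      volume {p : ℝ × ℝ | (![p.1, p.2, u] : Fin 3 → ℝ) ∈ Q ∧ p.1 < t + δ} := by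
  -- a.e. for each rational level
  have hrat : ∀ q : ℚ, ∀ᵐ u : ℝ,
      volume {p : ℝ × ℝ | (![p.1, p.2, u] : Fin 3 → ℝ) ∈ P ∧ p.1 < (q : ℝ)} ≤
        volume {p : ℝ × ℝ | (![p.1, p.2, u] : Fin 3 → ℝ) ∈ Q ∧ p.1 < (q : ℝ) + δ} := by
    intro q
    refine ae_le_of_forall_setLIntegral_le_of_sigmaFinite (measurable_volume_slice3_abscissa hP _)
      fun I hI _ => ?_
    rw [← volume_inter_heightSlab_inter_abscissa_eq_lintegral hP hI,
      ← volume_inter_heightSlab_inter_abscissa_eq_lintegral hQ hI]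
    exact hslab I hI q
  rw [← ae_all_iff] at hrat
  filter_upwards [hrat] with u hu
  intro t
  -- `{p₁ < t} = ⋃_{q < t, q ∈ ℚ} {p₁ < q}`, a directed countable union
  set F : {q : ℚ // (q : ℝ) < t} → Set (ℝ × ℝ) := fun q =>
    {p : ℝ × ℝ | (![p.1, p.2, u] : Fin 3 → ℝ) ∈ P ∧ p.1 < ((q : ℚ) : ℝ)} with hF
  have hunion : {p : ℝ × ℝ | (![p.1, p.2, u] : Fin 3 → ℝ) ∈ P ∧ p.1 < t} = ⋃ q, F q := by
    ext p
    simp only [mem_setOf_eq, mem_iUnion, hF]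
    constructor
    · rintro ⟨hpP, hpt⟩
      obtain ⟨q, hq1, hq2⟩ := exists_rat_btwn hpt
      exact ⟨⟨q, hq2⟩, hpP, hq1⟩
    · rintro ⟨q, hpP, hq⟩
      exact ⟨hpP, hq.trans q.2⟩
  have hdir : Directed (· ⊆ ·) F := by
    intro q₁ q₂
    rcases le_total ((q₁ : ℚ) : ℝ) ((q₂ : ℚ) : ℝ) with h | h
    · exact ⟨q₂, fun p hp => ⟨hp.1, lt_of_lt_of_le hp.2 h⟩, fun p hp => hp⟩
    · exact ⟨q₁, fun p hp => hp, fun p hp => ⟨hp.1, lt_of_lt_of_le hp.2 h⟩⟩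
  rw [hunion, hdir.measure_iUnion]
  refine iSup_le fun q => ?_
  calc volume (F q) ≤ volume {p : ℝ × ℝ | (![p.1, p.2, u] : Fin 3 → ℝ) ∈ Q ∧ p.1 < ((q : ℚ) : ℝ) + δ} :=
        hu q
    _ ≤ volume {p : ℝ × ℝ | (![p.1, p.2, u] : Fin 3 → ℝ) ∈ Q ∧ p.1 < t + δ} :=
        measure_mono fun p hp => ⟨hp.1, by linarith [hp.2, q.2]⟩

end Summit.Ventures.Crystal3D.Theorems.Chimera

end
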